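import Summits.Langlands.Langlands.Theses.K3KugaSatakeDescent
import Literature.NumberTheory.GaloisRepresentations.ArtinFormalismInductionProofs

/-!
# Refutation of `K3KugaSatakeDescent.SerreTypeAnchor` (item stmt-Langlands-3797)

The crux quantifies over an arbitrary infinite set `S : Set ℕ` of "primes", but its hypotheses
only speak about the members of `S` that ARE prime (`∀ p [Fact p.Prime], p ∈ S → …`) while its
conclusion demands `∃ p ∈ S, ∃ (_ : Fact p.Prime), …`.  For an infinite set `S` containing no
prime (witness: `S = {2k + 4 : k ∈ ℕ}`) the hypotheses hold vacuously for ANY families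
`rf`, `Wf` (we take the trivial representations) and the conclusion is false.  The remaining
data are instantiated by `E = ℚ(ζ₃)` (imaginary quadratic, Galois) and any
`τ ∈ Γ_ℚ ∖ res(Γ_E)` (exists because `[Γ_ℚ : res Γ_E] = [E : ℚ] = 2`,
`index_range_absGaloisRestrict_eq_finrank`).  Missing side condition for the planner:
`S ⊆ {p | p.Prime}` (or require `{p ∈ S | p.Prime}` infinite). [folklore]
-/

open Literature.NumberTheory.GaloisRepresentations
open Summit.Langlands.Langlands.Theses.K3KugaSatakeDescent

namespace Summit.Langlands.Langlands.Theorems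

/-- Refutes `K3KugaSatakeDescent.SerreTypeAnchor`: the residual-anchor crux is false as typed —
for the infinite prime-free set `S = {2k + 4 : k ∈ ℕ}` its hypotheses (stated only for the primes
of `S`) hold vacuously with the trivial families `rf = Wf = 1`, while its conclusion asks for a
prime in `S`; instantiated at `E = ℚ(ζ₃)` = `CyclotomicField 3 ℚ` (any imaginary quadratic
Galois `E` works) and any `τ ∉ res(Γ_E)` (index `[E:ℚ] = 2`). Witness: `S = {4, 6, 8, …}`.
[folklore] -/
theorem K3KugaSatakeDescentSerreTypeAnchor_refuted : ¬ SerreTypeAnchor := by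
  -- no number `2k + 4` is prime
  have hnp : ∀ k : ℕ, ¬ (2 * k + 4).Prime := by
    intro k hp
    have h2 : (2 : ℕ) ∣ 2 * k + 4 := ⟨k + 2, by ring⟩
    rcases hp.eq_one_or_self_of_dvd 2 h2 with h | h <;> omega
  -- abstract form: any imaginary quadratic Galois `E` gives a contradiction
  have key : ∀ (E : Type) [Field E] [NumberField E] [IsGalois ℚ E]
      [NumberField.IsTotallyComplex E], Module.finrank ℚ E = 2 → ¬ SerreTypeAnchor := by
    intro E _ _ _ _ hE h
    unfold SerreTypeAnchor at h
    -- an element of `Γ_ℚ` outside `res(Γ_E)`: the image has index `[E:ℚ] = 2`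
    obtain ⟨τ, hτ⟩ : ∃ τ : Field.absoluteGaloisGroup ℚ,
        τ ∉ Set.range (absGaloisRestrict ℚ E) := by
      by_contra hall
      push Not at hall
      have hidx := index_range_absGaloisRestrict_eq_finrank ℚ E
      have htop : (absGaloisRestrict ℚ E).range = ⊤ := by
        refine top_unique fun σ _ => ?_
        obtain ⟨x, hx⟩ := hall σ
        exact ⟨x, hx⟩
      rw [htop, Subgroup.index_top, hE] at hidx
      exact absurd hidx (by norm_num)
    -- the prime-free infinite set
    set S : Set ℕ := Set.range fun k : ℕ => 2 * k + 4 with hSdef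
    have hS : S.Infinite :=
      Set.infinite_range_of_injective fun a b (hab : 2 * a + 4 = 2 * b + 4) => by omega
    have key := h E hE τ hτ ∅ (fun _ => 0) S hS (fun p _ => 1) (fun p _ => 1) ?_
    · obtain ⟨p, ⟨k, rfl⟩, hp, -⟩ := key
      exact hnp k hp.out
    · intro p hp hpS
      obtain ⟨k, rfl⟩ := hpS
      exact (hnp k hp.out).elim
  -- instantiate at `ℚ(ζ₃)`, transporting its cyclotomic structure to the canonical `ℚ`-algebra
  -- structure `algebraRat` used by the abstract statement (`Algebra ℚ _` is a subsingleton)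
  obtain ⟨A, hA⟩ : ∃ A : Algebra ℚ (CyclotomicField 3 ℚ),
      @IsCyclotomicExtension {3} ℚ (CyclotomicField 3 ℚ) _ _ A :=
    ⟨_, CyclotomicField.isCyclotomicExtension 3 ℚ⟩
  have hAeq : A = (DivisionRing.toRatAlgebra : Algebra ℚ (CyclotomicField 3 ℚ)) :=
    Subsingleton.elim _ _
  subst hAeq
  haveI := hA
  haveI hG : IsGalois ℚ (CyclotomicField 3 ℚ) := IsCyclotomicExtension.isGalois {3} ℚ _
  haveI hT : NumberField.IsTotallyComplex (CyclotomicField 3 ℚ) :=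
    IsCyclotomicExtension.Rat.isTotallyComplex (n := 3) (CyclotomicField 3 ℚ) (by norm_num)
  have hE : Module.finrank ℚ (CyclotomicField 3 ℚ) = 2 := by
    rw [IsCyclotomicExtension.Rat.finrank 3 (CyclotomicField 3 ℚ)]
    decide
  exact key (CyclotomicField 3 ℚ) hE

end Summit.Langlands.Langlands.Theorems
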